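import Literature.AnabelianGeometry.AbsoluteAnabelian.AbsTopILem27iiiStepOfSigmaStarPrep
import Literature.AnabelianGeometry.AbsoluteAnabelian.AbsTopILem27iii
import Literature.AnabelianGeometry.AbsoluteAnabelian.AbsTopILem27iiiStepOfSigmaStarCharacter
import Literature.AnabelianGeometry.AbsoluteAnabelian.AbsTopIThm26iiiClauseOneOpen
import Literature.AnabelianGeometry.AbsoluteAnabelian.AbsTopIThm26ivProofs
import Literature.AnabelianGeometry.AbsoluteAnabelian.GaloisSubextensionProofs
import Literature.AnabelianGeometry.AbsoluteAnabelian.MLFGaloisGroupsProofs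
import Literature.NumberTheory.GaloisRepresentations.ContinuousCrossedHomNonPrincipal
import Literature.NumberTheory.GaloisRepresentations.SplitExtensionTwoCocycle
import HarnessLib

/-!
# [AbsTopI] Thm 2.6 (iii): the Lemma 2.7 (iii) step FROM condition (∗)_Σ — no Tate-module fact

S. Mochizuki, *Topics in Absolute Anabelian Geometry I: Generalities* (2012) [AbsTopI], Thm 2.6 (iii)
p. 22 and its proof p. 23 l. 31–47: "the spectral sequence yields [...] a pair of injections
`H¹(G, Hom(R_l, ℚ_l)) ↪ H¹(G, Hom(Δ^{ab-t}, ℚ_l)) ↪ H²(Π, ℚ_l)` if `l ∈ Σ` [cf. Lemma 2.7, (iii)] [...]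
`dim_{ℚ_l}(R_l ⊗ ℚ_l) ≥ 1`.  But this implies that for any `l′ ∈ Σ`, we have
`dim_{ℚ_{l′}}(R_{l′} ⊗ ℚ_{l′}) ≥ 1`, hence that `H¹(G, Hom(R_{l′}, ℚ_{l′})) ≠ 0`.  Thus [...]
`ε²_{l′}(Π) ≥ δ²_{l′}(Π) ≥ 1`, so `l′ ∈ θ²(Π)`."

PROOF-ONLY file (no definitions, no named facts) of the abc-iut row «HOOK-FROM-SIGMA-STAR»
(abc-iut-L4-lead RULINGS #8i (6) / #8j (6)).  abc-iut-w6-d073 isolated the residue of that paragraph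
which is NOT a theorem of ⟨MLF base, `Π` tfg, `Δ` pro-`Σ`⟩ as the predicate
`FundamentalExtension.Lem27iiiStep S` (`AbsTopILem27iii.lean`; finding F-w6d073-1).  Here it is
DERIVED — for every extension with MLF base data — from the inputs the cell already binds for
Thm 2.6 (ii): condition (∗)_Σ (`FundamentalExtension.SigmaStarCondition S`, the construction-data
reading "`T(A)/G` is a free `Ẑ_Σ`-module of rank independent of `l ∈ Σ`"), the splitting of the
extension over an open subgroup of `G` (a rational point of the Albanese), and [AbsTopI] Prop 2.2
(`Δ` topologically finitely generated):

* `FundamentalExtension.lem27iiiStep_of_sigmaStarCondition` — **`E.Lem27iiiStep S`**.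

Proof (print's argument with Lemma 2.7 (iii) replaced by an `H¹`-from-`H⁰` count): let `H ⊆ Π` be open
with a rank excess `δ¹_{l₀}(G_H) < δ¹_{l₀}(H)` at some `l₀ ∈ Σ`, and `l ∈ Σ` prime.  (a) By the upper
bound `δ¹(H) ≤ δ¹(G_H) + m` (abc-iut-w6-d074 g2, `freeProlRank_open_eq_of_coinvQuotient_trivial`) the
(∗)_Σ-quotient `Δ_H ↠ Ẑ_Σ^m` has `m ≥ 1`, so its `l`-th coordinate is a non-zero `H`-invariant
continuous additive character `ψ : Δ_H → ℚ_l`.  (b) The splitting `s : U → Π` gives an open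
`J₁ = H ∩ aug⁻¹(s⁻¹(H)) ⊆ H` which is a SEMIDIRECT PRODUCT `Δ_{J₁} ⋊ s(G_{J₁})`; `ψ` restricts to a
non-zero (finite index!) `J₁`-invariant character of `Δ_{J₁}`, i.e. a non-zero invariant vector of the
finite-dimensional (`Δ` tfg) representation `V = Hom_cont(Δ_{J₁}, ℚ_l)` of `G_{J₁}`.  (c) `G_{J₁}` is open
in `G_K`, so `H²_cont(G_{J₁}, ℚ_l) = 0` (abc-iut-w6-d073, `deltaInv_two_eq_zero_of_isOpen_absoluteGaloisGroup`)
and `δ¹_l(G_{J₁}) ≥ 1`; hence (`ContinuousCrossedHomNonPrincipal.lean`) `V` carries a NON-PRINCIPAL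
continuous crossed homomorphism `ξ`.  (d) The explicit `E₂^{1,1}`-cocycle of the split extension
(`SplitExtensionTwoCocycle.lean`) is then a non-zero class in `H²_cont(J₁, ℚ_l)`: `δ²_l(J₁) ≥ 1`.

Corollaries BY NAME through abc-iut-w6-d073's `AbsTopILem27iiiBridges.lean` ([AbsTopI] Thm 2.6 (iii)
both clauses, the general-`Θ` Thm 2.6 (v) at every `Σ ⊆ Primes`) are in the sequel
`AbsTopILem27iiiStepOfSigmaStarCorollaries.lean`.
HONEST FRAMING: refereed, undisputed paper; the geometric ORIGIN of (∗)_Σ (Tate modules of the Albanese,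
[AbsTopI] Lemma 2.7 (i)(ii)) is not formalised here — (∗)_Σ stays a hypothesis on data; seat
abc-iut-w6-d074; nothing here bears on [IUTchIII] Cor. 3.12; typed ≠ proved elsewhere.
-/

noncomputable section

namespace Literature.AnabelianGeometry.AbsoluteAnabelian

open Literature.NumberTheory.GaloisRepresentations

namespace FundamentalExtension

variable {E : FundamentalExtension.{0}}

/-- **The Lemma 2.7 (iii) step of [AbsTopI] Thm 2.6 (iii) from condition (∗)_Σ** (see the module
docstring for the proof): for every extension `1 → Δ → Π → G → 1` with MLF base data whose `Δ` is
topologically finitely generated ([AbsTopI] Prop 2.2), which splits over an open subgroup of `G`, and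
which satisfies (∗)_Σ, the predicate `E.Lem27iiiStep S` of abc-iut-w6-d073 holds: an open `H ⊆ Π`
with a rank excess `δ¹_{l₀}(G_H) < δ¹_{l₀}(H)` at some `l₀ ∈ Σ` contains, for every prime `l ∈ Σ`, an
open `H′` with `δ²_l(H′) ≥ 1`. [cite: MochizukiAbsTopI2012, Thm 2.6 (iii) proof p.23] -/
theorem lem27iiiStep_of_sigmaStarCondition (B : E.MLFBase) {S : Set ℕ} (hΔ : E.GeomTFG)
    (hs : E.SplitsOverOpenSubgroup) (hstar : E.SigmaStarCondition S) : E.Lem27iiiStep S := by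
  classical
  letI := B.instPrime; letI := B.instField; letI := B.instAlgebra; letI := B.instFinite
  intro H hH l₀ _ hl₀S hlt l _ hlS
  haveI : CompactSpace E.geom := isCompact_iff_compactSpace.mp E.isClosed_geom.isCompact
  /- (a) the invariant character on `Δ_H` -/
  obtain ⟨ψH, hψHc, hψHadd, hψHinv, x₀, hx₀⟩ :=
    exists_invariant_character_of_rankExcess hstar H hH hlt l hlS
  have hψHpow : ∀ (x : ↥(E.geom ⊓ H)) (k : ℕ), ψH (x ^ k) = k * ψH x := by
    intro x k
    induction k with
    | zero =>
      have h1 : ψH 1 = 0 := by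
        have := hψHadd 1 1
        rw [mul_one] at this
        linear_combination (-1 : ℚ_[l]) * this
      rw [pow_zero, h1, Nat.cast_zero, zero_mul]
    | succ k ih => rw [pow_succ, hψHadd, ih, Nat.cast_succ]; ring
  /- (b) the splitting and the open subgroup `J₁ = H ∩ aug⁻¹(s⁻¹ H)` -/
  obtain ⟨U, sU, hUo, hsU⟩ := hs
  let Qg : Subgroup E.gal := (H.comap sU.toMonoidHom).map U.subtype
  have hQg_mem : ∀ y : E.gal, y ∈ Qg ↔ ∃ hyU : y ∈ U, sU ⟨y, hyU⟩ ∈ H := by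
    intro y
    constructor
    · rintro ⟨u, hu, rfl⟩
      refine ⟨u.2, ?_⟩
      have hu' : sU u ∈ H := hu
      have hueq : (⟨U.subtype u, u.2⟩ : ↥U) = u := Subtype.ext rfl
      rw [hueq]
      exact hu'
    · rintro ⟨hyU, hy⟩
      exact ⟨⟨y, hyU⟩, hy, rfl⟩
  have hQgo : IsOpen (Qg : Set E.gal) := by
    have : (Qg : Set E.gal) = Subtype.val '' ((H.comap sU.toMonoidHom : Subgroup U) : Set U) :=
      Subgroup.coe_map _ _
    rw [this]
    exact hUo.isOpenMap_subtype_val _ (hH.preimage sU.continuous)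
  let J₁ : Subgroup E.arith := H ⊓ Qg.comap E.aug.toMonoidHom
  have hJ₁o : IsOpen (J₁ : Set E.arith) := hH.inter (hQgo.preimage E.aug.continuous)
  have hJ₁H : J₁ ≤ H := inf_le_left
  have hJ₁c : IsClosed (J₁ : Set E.arith) := J₁.isClosed_of_isOpen hJ₁o
  haveI : CompactSpace J₁ := isCompact_iff_compactSpace.mp hJ₁c.isCompact
  -- the image `G_{J₁}` and the projection `π`
  set GJ : Subgroup E.gal := J₁.map E.aug.toMonoidHom with hGJdef
  have hGJQ : GJ ≤ Qg := by
    rintro y ⟨x, hx, rfl⟩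
    exact hx.2
  haveI : Finite (E.arith ⧸ J₁) := Subgroup.quotient_finite_of_isOpen J₁ hJ₁o
  haveI : J₁.FiniteIndex := Subgroup.finiteIndex_of_finite_quotient
  haveI : GJ.FiniteIndex :=
    ⟨fun h0 => Subgroup.FiniteIndex.index_ne_zero (H := J₁)
      (Nat.eq_zero_of_zero_dvd (h0 ▸ Subgroup.index_map_dvd J₁ E.aug_surjective))⟩
  have hGJc : IsClosed (GJ : Set E.gal) := by
    rw [hGJdef, Subgroup.coe_map]
    exact (hJ₁c.isCompact.image (map_continuous E.aug)).isClosed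
  have hGJo : IsOpen (GJ : Set E.gal) := GJ.isOpen_of_isClosed_of_finiteIndex hGJc
  haveI : CompactSpace GJ := isCompact_iff_compactSpace.mp hGJc.isCompact
  let π : ↥J₁ →ₜ* ↥GJ :=
    ⟨E.aug.toMonoidHom.subgroupMap J₁,
      Continuous.subtype_mk ((map_continuous E.aug).comp continuous_subtype_val) _⟩
  have hπ_coe : ∀ x : ↥J₁, ((π x : ↥GJ) : E.gal) = E.aug x := fun _ => rfl
  -- the section `σ`
  have hyU : ∀ y : ↥GJ, (y : E.gal) ∈ U := fun y => ((hQg_mem _).1 (hGJQ y.2)).1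
  have hyH : ∀ y : ↥GJ, sU ⟨y, hyU y⟩ ∈ H := fun y => ((hQg_mem _).1 (hGJQ y.2)).2
  have hyJ : ∀ y : ↥GJ, sU ⟨y, hyU y⟩ ∈ J₁ := fun y => by
    refine ⟨hyH y, ?_⟩
    change E.aug (sU ⟨y, hyU y⟩) ∈ Qg
    rw [hsU]
    exact hGJQ y.2
  let σ : ↥GJ →ₜ* ↥J₁ :=
    { toFun := fun y => ⟨sU ⟨y, hyU y⟩, hyJ y⟩
      map_one' := Subtype.ext (by
        change sU ⟨((1 : ↥GJ) : E.gal), hyU 1⟩ = 1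
        rw [← map_one sU]
        rfl)
      map_mul' := fun y z => Subtype.ext (by
        change sU ⟨((y * z : ↥GJ) : E.gal), hyU (y * z)⟩ = sU ⟨y, hyU y⟩ * sU ⟨z, hyU z⟩
        rw [← map_mul]
        rfl)
      continuous_toFun :=
        (sU.continuous.comp (continuous_subtype_val.subtype_mk _)).subtype_mk _ }
  have hσ_coe : ∀ y : ↥GJ, ((σ y : ↥J₁) : E.arith) = sU ⟨y, hyU y⟩ := fun _ => rfl
  have hσ : ∀ y : ↥GJ, π (σ y) = y := fun y =>
    Subtype.ext (by rw [hπ_coe, hσ_coe, hsU])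
  have hσH : ∀ y : ↥GJ, ((σ y : ↥J₁) : E.arith) ∈ H := fun y => hyH y
  -- the kernel `N = Δ_{J₁}`
  let N : Subgroup ↥J₁ := π.toMonoidHom.ker
  have hN : ∀ x : ↥J₁, x ∈ N ↔ π x = 1 := fun x => Iff.rfl
  have hNaug : ∀ x : ↥J₁, x ∈ N ↔ E.aug x = 1 := by
    intro x
    rw [hN, Subtype.ext_iff, hπ_coe]
    rfl
  have hNgeom : ∀ a : ↥N, ((a : ↥J₁) : E.arith) ∈ E.geom ⊓ H := fun a =>
    ⟨(E.mem_geom).2 ((hNaug _).1 a.2), hJ₁H a.1.2⟩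
  /- `N` is topologically finitely generated (open in `Δ`, Prop 2.2) -/
  have hNtfg : IsTopologicallyFinitelyGenerated ↥N := by
    let Kg : Subgroup E.geom := (E.geom ⊓ J₁).subgroupOf E.geom
    have hKgo : IsOpen (Kg : Set E.geom) := by
      have hK : (Kg : Set E.geom) = Subtype.val ⁻¹' (J₁ : Set E.arith) := by
        ext x
        simp only [Kg, SetLike.mem_coe, Subgroup.mem_subgroupOf, Subgroup.mem_inf, Set.mem_preimage]
        exact ⟨fun h => h.2, fun h => ⟨x.2, h⟩⟩
      rw [hK]
      exact hJ₁o.preimage continuous_subtype_val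
    have hKtfg : IsTopologicallyFinitelyGenerated Kg := hΔ.subgroup_isOpen Kg hKgo
    have hmemJ : ∀ x : ↥Kg, ((x : E.geom) : E.arith) ∈ J₁ := fun x =>
      (Subgroup.mem_subgroupOf.1 x.2).2
    have hmemN : ∀ x : ↥Kg, (⟨((x : E.geom) : E.arith), hmemJ x⟩ : ↥J₁) ∈ N := fun x =>
      (hNaug _).2 ((E.mem_geom).1 (x : E.geom).2)
    let f : ↥Kg →ₜ* ↥N :=
      { toFun := fun x => ⟨⟨((x : E.geom) : E.arith), hmemJ x⟩, hmemN x⟩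
        map_one' := rfl
        map_mul' := fun _ _ => rfl
        continuous_toFun := ((continuous_subtype_val.comp continuous_subtype_val).subtype_mk _).subtype_mk _ }
    refine IsTopologicallyFinitelyGenerated.of_surjective f (fun a => ?_) hKtfg
    refine ⟨⟨⟨((a : ↥J₁) : E.arith), (hNgeom a).1⟩, Subgroup.mem_subgroupOf.2 ⟨(hNgeom a).1, a.1.2⟩⟩,
      Subtype.ext (Subtype.ext rfl)⟩
  /- the space `V` of continuous additive characters `N → ℚ_l` and the conjugation representation -/
  let V : Submodule ℚ_[l] (↥N → ℚ_[l]) :=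
    { carrier := {v | Continuous v ∧ ∀ a b : ↥N, v (a * b) = v a + v b}
      zero_mem' := ⟨continuous_const, fun a b => by simp only [Pi.zero_apply, add_zero]⟩
      add_mem' := fun {v w} hv hw => ⟨hv.1.add hw.1, fun a b => by
        simp only [Pi.add_apply, hv.2, hw.2]; ring⟩
      smul_mem' := fun c v hv => ⟨hv.1.const_smul c, fun a b => by
        simp only [Pi.smul_apply, smul_eq_mul, hv.2, mul_add]⟩ }
  have hVmem : ∀ v : ↥N → ℚ_[l], v ∈ V ↔ Continuous v ∧ ∀ a b : ↥N, v (a * b) = v a + v b :=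
    fun v => Iff.rfl
  haveI : Module.Finite ℚ_[l] V :=
    finite_submodule_of_continuous_additive hNtfg l V fun v hv => hv
  -- conjugation by `σ(y)⁻¹` on `N`
  have hconj_cont : ∀ g : ↥J₁, Continuous fun a : ↥N => (MulAut.conjNormal g a : ↥N) := by
    intro g
    refine continuous_induced_rng.2 ?_
    have : (Subtype.val ∘ fun a : ↥N => (MulAut.conjNormal g a : ↥N)) =
        fun a : ↥N => g * (a : ↥J₁) * g⁻¹ := by
      funext a; simp only [Function.comp_apply, MulAut.conjNormal_apply]
    rw [this]
    fun_prop
  have hconj_cont' : ∀ a : ↥N, Continuous fun y : ↥GJ => (MulAut.conjNormal (σ y)⁻¹ a : ↥N) := by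
    intro a
    refine continuous_induced_rng.2 ?_
    have : (Subtype.val ∘ fun y : ↥GJ => (MulAut.conjNormal (σ y)⁻¹ a : ↥N)) =
        fun y : ↥GJ => (σ y)⁻¹ * (a : ↥J₁) * (σ y)⁻¹⁻¹ := by
      funext y; simp only [Function.comp_apply, MulAut.conjNormal_apply]
    rw [this]
    fun_prop
  have hstab : ∀ (y : ↥GJ), V ≤ V.comap
      (LinearMap.funLeft ℚ_[l] ℚ_[l] (fun a : ↥N => (MulAut.conjNormal (σ y)⁻¹ a : ↥N))) := by
    intro y v hv
    rw [Submodule.mem_comap, hVmem]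
    refine ⟨hv.1.comp (hconj_cont _), fun a b => ?_⟩
    simp only [LinearMap.funLeft_apply, map_mul, hv.2]
  let ρ : Representation ℚ_[l] ↥GJ V :=
    { toFun := fun y => (LinearMap.funLeft ℚ_[l] ℚ_[l]
        (fun a : ↥N => (MulAut.conjNormal (σ y)⁻¹ a : ↥N))).restrict (hstab y)
      map_one' := by
        apply LinearMap.ext
        intro v
        apply Subtype.ext
        funext a
        change (v : ↥N → ℚ_[l]) (MulAut.conjNormal (σ 1)⁻¹ a) = (v : ↥N → ℚ_[l]) a
        rw [map_one, inv_one, map_one, MulAut.one_apply]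
      map_mul' := fun y z => by
        apply LinearMap.ext
        intro v
        apply Subtype.ext
        funext a
        change (v : ↥N → ℚ_[l]) (MulAut.conjNormal (σ (y * z))⁻¹ a) =
          (v : ↥N → ℚ_[l]) (MulAut.conjNormal (σ z)⁻¹ (MulAut.conjNormal (σ y)⁻¹ a))
        have he : (MulAut.conjNormal (σ (y * z))⁻¹ a : ↥N) =
            MulAut.conjNormal (σ z)⁻¹ (MulAut.conjNormal (σ y)⁻¹ a) := by
          apply Subtype.ext
          simp only [MulAut.conjNormal_apply, map_mul, MulAut.mul_apply, mul_inv_rev, inv_inv,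
            mul_assoc]
        rw [he] }
  have hρ_apply : ∀ (y : ↥GJ) (v : V) (a : ↥N),
      ((ρ y v : V) : ↥N → ℚ_[l]) a = (v : ↥N → ℚ_[l]) (MulAut.conjNormal (σ y)⁻¹ a) :=
    fun _ _ _ => rfl
  /- matrix coefficients of `ρ` are continuous: evaluations span the dual of `V` -/
  have hρ : ∀ (v : V) (f : Module.Dual ℚ_[l] V), Continuous fun y => f (ρ y v) := by
    intro v f
    -- the evaluations
    let ev : ↥N → Module.Dual ℚ_[l] V := fun a => (LinearMap.proj a).comp V.subtype
    have hev : ∀ (a : ↥N) (w : V), ev a w = (w : ↥N → ℚ_[l]) a := fun _ _ => rfl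
    have hspan : Submodule.span ℚ_[l] (Set.range ev) = ⊤ := by
      refine Submodule.span_eq_top_of_ne_zero fun z hz => ?_
      have hz' : (z : ↥N → ℚ_[l]) ≠ 0 := fun h => hz (Subtype.ext h)
      obtain ⟨a, ha⟩ := Function.ne_iff.1 hz'
      exact ⟨ev a, ⟨a, rfl⟩, by rwa [hev]⟩
    -- the functionals with continuous coefficient form a submodule containing the evaluations
    let T : Submodule ℚ_[l] (Module.Dual ℚ_[l] V) :=
      { carrier := {f | Continuous fun y => f (ρ y v)}
        zero_mem' := show Continuous fun y => (0 : Module.Dual ℚ_[l] V) (ρ y v) from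
          continuous_const
        add_mem' := fun {f g} (hf : Continuous fun y => f (ρ y v))
            (hg : Continuous fun y => g (ρ y v)) =>
          show Continuous fun y => (f + g) (ρ y v) from (hf.add hg).congr fun _ => rfl
        smul_mem' := fun c f (hf : Continuous fun y => f (ρ y v)) =>
          show Continuous fun y => (c • f) (ρ y v) from (hf.const_smul c).congr fun _ => rfl }
    have hT : ∀ g : Module.Dual ℚ_[l] V, g ∈ T ↔ Continuous fun y => g (ρ y v) := fun _ => Iff.rfl
    have hle : Submodule.span ℚ_[l] (Set.range ev) ≤ T := by
      refine Submodule.span_le.2 ?_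
      rintro _ ⟨a, rfl⟩
      change Continuous fun y => ev a (ρ y v)
      simp only [hev, hρ_apply]
      exact v.2.1.comp (hconj_cont' a)
    rw [hspan, top_le_iff] at hle
    exact (hT f).1 (hle ▸ Submodule.mem_top)
  /- the invariant vector: `ψH` restricted to `N = Δ_{J₁}` -/
  let ψN : ↥N → ℚ_[l] := fun a => ψH ⟨((a : ↥J₁) : E.arith), hNgeom a⟩
  have hψN : ψN ∈ V := by
    refine ⟨hψHc.comp ((continuous_subtype_val.comp continuous_subtype_val).subtype_mk _),
      fun a b => ?_⟩
    change ψH ⟨((a * b : ↥N) : ↥J₁), _⟩ = ψH ⟨(a : ↥J₁), _⟩ + ψH ⟨(b : ↥J₁), _⟩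
    rw [← hψHadd]
    rfl
  have hψNinv : (⟨ψN, hψN⟩ : V) ∈ ρ.invariants := by
    rw [Representation.mem_invariants]
    intro y
    apply Subtype.ext
    funext a
    rw [hρ_apply]
    change ψH ⟨(((MulAut.conjNormal (σ y)⁻¹ a : ↥N) : ↥J₁) : E.arith), _⟩ = ψH ⟨(a : ↥J₁), _⟩
    have hh : (((σ y : ↥J₁) : E.arith))⁻¹ ∈ H := H.inv_mem (hσH y)
    rw [← hψHinv _ hh ⟨(a : ↥J₁), hNgeom a⟩]
    congr 1
  have hψNne : (⟨ψN, hψN⟩ : V) ≠ 0 := by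
    -- a power of `x₀` lies in the finite-index `J₁`
    have hidx : (J₁.subgroupOf (E.geom ⊓ H)).index ≠ 0 := Subgroup.FiniteIndex.index_ne_zero
    obtain ⟨n, hn0, -, hn⟩ := Subgroup.exists_pow_mem_of_index_ne_zero hidx x₀
    rw [Subgroup.mem_subgroupOf, Subgroup.coe_pow] at hn
    have haug : E.aug (((x₀ : E.arith)) ^ n) = 1 := by
      rw [map_pow, (E.mem_geom).1 x₀.2.1, one_pow]
    let a₀ : ↥N := ⟨⟨(x₀ : E.arith) ^ n, hn⟩, (hNaug _).2 haug⟩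
    intro h0
    have h1 : ψN a₀ = 0 := by
      have := congrArg (fun w : V => (w : ↥N → ℚ_[l]) a₀) h0
      simpa using this
    have h2 : ψN a₀ = n := by
      change ψH ⟨(x₀ : E.arith) ^ n, _⟩ = n
      have : (⟨(x₀ : E.arith) ^ n, hNgeom a₀⟩ : ↥(E.geom ⊓ H)) = x₀ ^ n := Subtype.ext rfl
      rw [this, hψHpow, hx₀, mul_one]
    rw [h1] at h2
    exact hn0.ne' (by exact_mod_cast h2.symm)
  have hinv : ρ.invariants ≠ ⊥ := fun h =>
    hψNne ((Submodule.mem_bot ℚ_[l]).1 (h ▸ hψNinv))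
  /- `G_{J₁}` is an open subgroup of `G_K`: `H²_cont(G_{J₁}, ℚ_l) = 0` and `δ¹_l(G_{J₁}) ≥ 1` -/
  obtain ⟨e₂⟩ := nonempty_continuousMulEquiv_subgroup_map_equiv B.galIso GJ
  have hGJ'o : IsOpen ((GJ.map (B.galIso : E.gal →* Field.absoluteGaloisGroup B.K)) :
      Set (Field.absoluteGaloisGroup B.K)) := by
    rw [Subgroup.coe_map]
    exact B.galIso.toHomeomorph.isOpenMap _ hGJo
  have hδ2 : deltaInv ↥GJ 2 l = 0 := by
    rw [deltaInv_eq_of_continuousMulEquiv e₂ 2 l]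
    exact deltaInv_two_eq_zero_of_isOpen_absoluteGaloisGroup B.p B.K l hGJ'o
  have hH2 := forall_twoCocycle_exists_of_deltaInv_two_eq_zero l hδ2
  have h1 : 1 ≤ freeProlRank ↥GJ l := by
    rw [freeProlRank_eq_of_continuousMulEquiv e₂ l]
    exact one_le_freeProlRank_of_isOpen_absoluteGaloisGroup B.p B.K _ hGJ'o l
  obtain ⟨φ, hφc, hφadd, hφ0⟩ := exists_continuous_additive_ne_zero_of_one_le_freeProlRank l h1
  /- (c) a non-principal continuous crossed homomorphism `ξ : G_{J₁} → V` -/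
  obtain ⟨ξ, hξ1, hξ2, hξ3⟩ :=
    exists_crossedHom_not_principal_of_invariants_ne_bot hH2 φ hφc hφadd hφ0 ρ hρ hinv
  /- (d) the split-extension cocycle is a non-zero class in `H²_cont(J₁, ℚ_l)` -/
  let bV := Module.finBasis ℚ_[l] V
  have hξexp : ∀ (y : ↥GJ) (a : ↥N), ((ξ y : V) : ↥N → ℚ_[l]) a =
      ∑ i, bV.coord i (ξ y) * ((bV i : V) : ↥N → ℚ_[l]) a := by
    intro y a
    conv_lhs => rw [← bV.sum_repr (ξ y)]
    simp only [Submodule.coe_sum, Submodule.coe_smul, Finset.sum_apply, Pi.smul_apply, smul_eq_mul,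
      Module.Basis.coord_apply]
  have hξcont : Continuous fun p : ↥GJ × ↥N => ((ξ p.1 : V) : ↥N → ℚ_[l]) p.2 := by
    simp_rw [hξexp]
    refine continuous_finsetSum _ fun i _ => ?_
    exact ((hξ2 (bV.coord i)).comp continuous_fst).mul ((bV i).2.1.comp continuous_snd)
  obtain ⟨f, hf⟩ := exists_twoCocycleClass_ne_zero_of_split π N hN σ hσ
    (fun y a => ((ξ y : V) : ↥N → ℚ_[l]) a)
    (fun y a b => (ξ y).2.2 a b)
    (fun y z a => by
      change ((ξ (y * z) : V) : ↥N → ℚ_[l]) a = _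
      rw [hξ1, Submodule.coe_add, Pi.add_apply, hρ_apply])
    hξcont
    (fun v hvc hvadd => by
      by_contra hall
      push Not at hall
      refine hξ3 ⟨v, hvc, hvadd⟩ (funext fun y => Subtype.ext (funext fun a => ?_))
      rw [hall y a, Submodule.coe_sub, Pi.sub_apply, hρ_apply])
  exact ⟨J₁, hJ₁o, hJ₁H, one_le_deltaInv_two_of_twoCocycleClass_ne_zero l f hf⟩

end FundamentalExtension

end Literature.AnabelianGeometry.AbsoluteAnabelian
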